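import Literature.Probability.LatticeModels.KCFrozenBoundaryConnected
import Literature.Probability.LatticeModels.PlaquetteConnectivity
import Literature.Probability.LatticeModels.MeshInteriorHoleFree
import HarnessLib

/-!
# The Kadanoff–Ceva primitive on a lattice component of the discrete domain, with all combinatorial hypotheses discharged

Topic `Literature/Probability/LatticeModels`. Chelkak–Hongler–Izyurov 2015, §2.1 and Prop. 3.6: the
discrete domains of CHI15 are CONNECTED and simply connected unions of faces, and on such a domain
the primitive `H` of the spinor observable exists, is sub/superharmonic, and satisfies the Dirichlet
condition on the boundary. The tree's assembly `exists_kcCuts_primitive` / `…_mesh`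
(`IsingDisorderLaplacian.lean`) takes two combinatorial hypotheses — the free sites are hole-free as
cells, and the plaquettes touching them are usably reachable from the source plaquette — and the
global normalisation `Hw|_∂ ≡ const` needs a third (lattice-preconnectedness of the free sites and
of their complement, `KCFrozenBoundaryConnected.lean`). The free volume `meshInteriorFinset Ω δ` of
the tree's discretisation need not be lattice-connected at a given mesh (necks of width `≤ 2δ`), so
the Kadanoff–Ceva analysis is to be run on the lattice COMPONENT of the marked point; this file
discharges all three hypotheses for such a component:

* `HoleFree.of_adjClosed` — a part of a hole-free set of sites closed under lattice adjacency inside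
  it (a union of its lattice components) is hole-free;
* **`exists_kcCuts_primitive_mesh_part`** — on a lattice-preconnected, adjacency-closed part `Λ₁`
  of the hole-free free volume `meshInteriorFinset Ω δ` (graph `discreteDomainGraph Ω δ`, `+`
  boundary condition, any background set `B`, any `β`): an admissible cut system from any source
  plaquette touching `Λ₁`, empty at the source and of odd side-parity elsewhere, a primitive pair
  `(Hw, Hb)` on the filled set of touching plaquettes, AND `Hw` constant on all frozen corners of
  its plaquettes (CHI15 Prop. 3.6 (i)–(ii) in Kadanoff–Ceva form);
* **`JordanDomain.exists_kcCuts_primitive_mesh_part`** — the same for a Jordan domain, where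
  hole-freeness is automatic at every mesh (`JordanDomain.holeFree_meshInteriorFinset`).

Everything is proved; no named fact.

## References

* D. Chelkak, C. Hongler, K. Izyurov, Ann. of Math. 181 (2015) = arXiv:1202.2838, §2.1, Prop. 3.6
  — `ChelkakHonglerIzyurovAnnals2015`.
-/

noncomputable section

namespace Literature.Probability.LatticeModels

open Finset SimpleGraph Relation

/-! ### Parts of hole-free sets closed under adjacency are hole-free -/

section Part

variable {Λ Λ₁ : Finset (Site 2)}

/-- Face-step chains avoiding `Λ` avoid every `Λ₁ ⊆ Λ`. [folklore] -/
theorem reflTransGen_faceStep_mono {P Q : Set (Site 2)} (h : Q ⊆ P) {g g' : Site 2}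
    (hs : ReflTransGen (FaceStep P) g g') : ReflTransGen (FaceStep Q) g g' := by
  induction hs with
  | refl => exact ReflTransGen.refl
  | tail _ hbc ih => exact ih.tail (hbc.mono h)

/-- **A part of a hole-free set of sites which is closed under lattice adjacency inside the set (a
union of lattice components) is hole-free**: a site of `Λ ∖ Λ₁` climbs inside its part of `Λ ∖ Λ₁`
to a topmost site, steps up out of `Λ`, and escapes from there. [cite: ChelkakHonglerIzyurovAnnals2015, §2.1] -/
theorem HoleFree.of_adjClosed (hΛ : HoleFree (↑Λ : Set (Site 2))) (hsub : Λ₁ ⊆ Λ)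
    (hclosed : ∀ x ∈ Λ₁, ∀ y ∈ Λ, (zdGraph 2).Adj x y → y ∈ Λ₁) : HoleFree (↑Λ₁ : Set (Site 2)) := by
  classical
  have hsub' : (↑Λ₁ : Set (Site 2)) ⊆ ↑Λ := Finset.coe_subset.2 hsub
  intro g hg M
  have hgΛ₁ : g ∉ Λ₁ := hg
  by_cases hgΛ : g ∈ Λ
  · -- the part of `Λ ∖ Λ₁` reachable from `g`
    set Rel : Site 2 → Site 2 → Prop := fun a b => (zdGraph 2).Adj a b ∧ a ∈ Λ \ Λ₁ ∧ b ∈ Λ \ Λ₁ with hRel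
    have hlift : ∀ t, ReflTransGen Rel g t → ReflTransGen (FaceStep (↑Λ₁ : Set (Site 2))) g t := by
      intro t ht
      induction ht with
      | refl => exact ReflTransGen.refl
      | tail _ hbc ih =>
        exact ih.tail ⟨hbc.1, fun h => (Finset.mem_sdiff.1 hbc.2.1).2 h, fun h => (Finset.mem_sdiff.1 hbc.2.2).2 h⟩
    set R : Finset (Site 2) := (Λ \ Λ₁).filter fun t => ReflTransGen Rel g t with hR
    have hgR : g ∈ R := Finset.mem_filter.2 ⟨Finset.mem_sdiff.2 ⟨hgΛ, hgΛ₁⟩, ReflTransGen.refl⟩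
    obtain ⟨t, htR, htmax⟩ := R.exists_max_image (fun t : Site 2 => t 1) ⟨g, hgR⟩
    have htΛ : t ∈ Λ \ Λ₁ := (Finset.mem_filter.1 htR).1
    have hgt : ReflTransGen Rel g t := (Finset.mem_filter.1 htR).2
    -- the site above `t` is outside `Λ`
    have hadj : (zdGraph 2).Adj t (t + cornerUnit 1) := cSrc_mem_edgeSet (t, 1)
    have ht'Λ₁ : t + cornerUnit 1 ∉ Λ₁ := fun h =>
      (Finset.mem_sdiff.1 htΛ).2 (hclosed _ h t (Finset.mem_sdiff.1 htΛ).1 hadj.symm)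
    have ht'Λ : t + cornerUnit 1 ∉ Λ := by
      intro h
      have ht'R : t + cornerUnit 1 ∈ R := Finset.mem_filter.2
        ⟨Finset.mem_sdiff.2 ⟨h, ht'Λ₁⟩, hgt.tail ⟨hadj, htΛ, Finset.mem_sdiff.2 ⟨h, ht'Λ₁⟩⟩⟩
      have hle := htmax _ ht'R
      have h1 := (nsmul_cornerUnit_one_apply t 1).2
      rw [one_smul] at h1
      rw [h1] at hle
      push_cast at hle
      omega
    obtain ⟨g', hg'M, hchain⟩ := hΛ (t + cornerUnit 1) (by exact ht'Λ) M
    refine ⟨g', hg'M, ?_⟩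
    -- `g ⇝ t` inside `Λ ∖ Λ₁`, `t → t + e₁`, `t + e₁ ⇝ g'` avoiding `Λ ⊇ Λ₁`
    have h1 : ReflTransGen (FaceStep (↑Λ₁ : Set (Site 2))) g t := hlift t hgt
    have h2 : FaceStep (↑Λ₁ : Set (Site 2)) t (t + cornerUnit 1) :=
      ⟨hadj, fun h => (Finset.mem_sdiff.1 htΛ).2 h, fun h => ht'Λ₁ h⟩
    exact (h1.tail h2).trans (reflTransGen_faceStep_mono hsub' hchain)
  · obtain ⟨g', hg'M, hchain⟩ := hΛ g (by exact hgΛ) M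
    exact ⟨g', hg'M, reflTransGen_faceStep_mono hsub' hchain⟩

end Part

/-! ### The primitive on a lattice component of `Ω_δ` -/

section Mesh

/-- **The critical Kadanoff–Ceva primitive on a lattice component of `Ω_δ`, all combinatorial
hypotheses discharged.** Let `Λ₁` be a lattice-preconnected part of the free volume
`meshInteriorFinset Ω δ`, closed under lattice adjacency inside it (i.e. one of its lattice
components), the free volume being hole-free as a set of cells (automatic for Jordan domains,
`JordanDomain.exists_kcCuts_primitive_mesh_part`). Then for every `β`, background set `B` and source
plaquette `p₀` touching `Λ₁` there are an admissible cut system from `p₀` on the filled set of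
plaquettes touching `Λ₁` (empty at `p₀`, odd side-parity elsewhere) and a primitive pair `(Hw, Hb)`
of the `+`-boundary-condition Kadanoff–Ceva flux form on the graph `discreteDomainGraph Ω δ`, with
`Hw` CONSTANT on the frozen corners of its plaquettes (Chelkak–Hongler–Izyurov 2015, Prop. 3.6 (i)
and the Dirichlet condition (ii)). [cite: ChelkakHonglerIzyurovAnnals2015, Prop. 3.6 and §2.1] -/
theorem exists_kcCuts_primitive_mesh_part (Ω : Set ℂ) (δ : ℝ) {Λ₁ : Finset (Site 2)}
    (hsub : Λ₁ ⊆ meshInteriorFinset Ω δ)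
    (hclosed : ∀ x ∈ Λ₁, ∀ y ∈ meshInteriorFinset Ω δ, (zdGraph 2).Adj x y → y ∈ Λ₁)
    (hconn : ((zdGraph 2).induce (↑Λ₁ : Set (Site 2))).Preconnected)
    (hHF : HoleFree (↑(meshInteriorFinset Ω δ) : Set (Site 2)))
    {p₀ : Site 2} (hp₀ : p₀ ∈ touchPlaquettes Λ₁) (β : ℝ) (B : Finset (Site 2)) :
    ∃ (cut : Site 2 → Finset (Sym2 (Site 2))) (Hw Hb : Site 2 → ℝ),
      IsKCCuts (discreteDomainGraph Ω δ) Λ₁ cut ↑(fillFinset (touchPlaquettes Λ₁)) ∧ cut p₀ = ∅ ∧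
      (∀ p ∈ touchPlaquettes Λ₁, p ≠ p₀ → Odd #(Finset.univ.filter fun j : Fin 4 => plaqSide p j ∈ cut p)) ∧
      IsKCPrimitive (discreteDomainGraph Ω δ) Λ₁ β .plus B cut Hw Hb ↑(fillFinset (touchPlaquettes Λ₁)) ∧
      ∀ (v v' : Site 2) (k k' : Fin 4), v ∉ Λ₁ → faceAt v k ∈ fillFinset (touchPlaquettes Λ₁) →
        v' ∉ Λ₁ → faceAt v' k' ∈ fillFinset (touchPlaquettes Λ₁) → Hw v' = Hw v := by
  have hHF₁ : HoleFree (↑Λ₁ : Set (Site 2)) := hHF.of_adjClosed hsub hclosed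
  obtain ⟨cut, Hw, Hb, hcuts, h0, hodd, hprim⟩ := exists_kcCuts_primitive (discreteDomainGraph Ω δ)
    (fun _ hv k => discreteDomainGraph_adj_of_mem_meshInteriorFinset (hsub hv) k)
    (discreteDomainGraph_le_zdGraph Ω δ) hHF₁ (usable_connectivity_of_preconnected hconn hp₀) β 1 B
  refine ⟨cut, Hw, Hb, hcuts, h0, hodd, hprim, fun v v' k k' hv hk hv' hk' => ?_⟩
  exact hprim.hw_eq_of_preconnected hconn (induce_compl_preconnected_of_holeFree hHF₁) hv hk hv' hk'

/-- **The same for a Jordan domain**, where the free volume is hole-free at every mesh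
(`JordanDomain.holeFree_meshInteriorFinset`). [cite: ChelkakHonglerIzyurovAnnals2015, Prop. 3.6 and §2.1] -/
theorem _root_.Literature.Probability.RandomPlanarGeometry.JordanDomain.exists_kcCuts_primitive_mesh_part
    (D : Literature.Probability.RandomPlanarGeometry.JordanDomain) (δ : ℝ) {Λ₁ : Finset (Site 2)}
    (hsub : Λ₁ ⊆ meshInteriorFinset D.carrier δ)
    (hclosed : ∀ x ∈ Λ₁, ∀ y ∈ meshInteriorFinset D.carrier δ, (zdGraph 2).Adj x y → y ∈ Λ₁)
    (hconn : ((zdGraph 2).induce (↑Λ₁ : Set (Site 2))).Preconnected)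
    {p₀ : Site 2} (hp₀ : p₀ ∈ touchPlaquettes Λ₁) (β : ℝ) (B : Finset (Site 2)) :
    ∃ (cut : Site 2 → Finset (Sym2 (Site 2))) (Hw Hb : Site 2 → ℝ),
      IsKCCuts (discreteDomainGraph D.carrier δ) Λ₁ cut ↑(fillFinset (touchPlaquettes Λ₁)) ∧ cut p₀ = ∅ ∧
      (∀ p ∈ touchPlaquettes Λ₁, p ≠ p₀ → Odd #(Finset.univ.filter fun j : Fin 4 => plaqSide p j ∈ cut p)) ∧
      IsKCPrimitive (discreteDomainGraph D.carrier δ) Λ₁ β .plus B cut Hw Hb ↑(fillFinset (touchPlaquettes Λ₁)) ∧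
      ∀ (v v' : Site 2) (k k' : Fin 4), v ∉ Λ₁ → faceAt v k ∈ fillFinset (touchPlaquettes Λ₁) →
        v' ∉ Λ₁ → faceAt v' k' ∈ fillFinset (touchPlaquettes Λ₁) → Hw v' = Hw v :=
  Literature.Probability.LatticeModels.exists_kcCuts_primitive_mesh_part D.carrier δ hsub hclosed hconn
    (D.holeFree_meshInteriorFinset δ) hp₀ β B

end Mesh

/-! ### The primitive on `ℤ²` itself -/

section Zd

/-- **The critical Kadanoff–Ceva primitive on a hole-free, lattice-preconnected set of free sites of
`ℤ²`** (graph `zdGraph 2`, any fixed boundary condition `η`, background set `B`, any `β`): cuts from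
any source plaquette touching the free sites, a primitive pair on the filled set of touching
plaquettes, and `Hw` constant on the frozen corners — the form in which the `ℤ²` estimates of
`KCCornerDecay.lean` (Kramers–Wannier duality) apply directly; the Ising measure of `Ω_δ` in a
lattice component of its free volume is the `ℤ²` measure in that component
(`isingExpect_discreteDomainGraph_eq`-type transfer). [cite: ChelkakHonglerIzyurovAnnals2015, Prop. 3.6 and §2.1] -/
theorem exists_kcCuts_primitive_zd {Λ : Finset (Site 2)}
    (hconn : ((zdGraph 2).induce (↑Λ : Set (Site 2))).Preconnected) (hHF : HoleFree (↑Λ : Set (Site 2)))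
    {p₀ : Site 2} (hp₀ : p₀ ∈ touchPlaquettes Λ) (β : ℝ) (η : SpinConfig (Site 2)) (B : Finset (Site 2)) :
    ∃ (cut : Site 2 → Finset (Sym2 (Site 2))) (Hw Hb : Site 2 → ℝ),
      IsKCCuts (zdGraph 2) Λ cut ↑(fillFinset (touchPlaquettes Λ)) ∧ cut p₀ = ∅ ∧
      (∀ p ∈ touchPlaquettes Λ, p ≠ p₀ → Odd #(Finset.univ.filter fun j : Fin 4 => plaqSide p j ∈ cut p)) ∧
      IsKCPrimitive (zdGraph 2) Λ β (.fixed η) B cut Hw Hb ↑(fillFinset (touchPlaquettes Λ)) ∧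
      ∀ (v v' : Site 2) (k k' : Fin 4), v ∉ Λ → faceAt v k ∈ fillFinset (touchPlaquettes Λ) →
        v' ∉ Λ → faceAt v' k' ∈ fillFinset (touchPlaquettes Λ) → Hw v' = Hw v := by
  obtain ⟨cut, Hw, Hb, hcuts, h0, hodd, hprim⟩ := exists_kcCuts_primitive (zdGraph 2)
    (fun v _ k => cSrc_mem_edgeSet (v, k)) le_rfl hHF (usable_connectivity_of_preconnected hconn hp₀) β η B
  refine ⟨cut, Hw, Hb, hcuts, h0, hodd, hprim, fun v v' k k' hv hk hv' hk' => ?_⟩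
  exact hprim.hw_eq_of_preconnected hconn (induce_compl_preconnected_of_holeFree hHF) hv hk hv' hk'

end Zd

end Literature.Probability.LatticeModels
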